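import Literature.NumberTheory.IwasawaTheory.ZpExtensionLayerRamificationDichotomy
import Literature.NumberTheory.IwasawaTheory.FukudaCountingLemmas
import Literature.NumberTheory.GaloisRepresentations.ArtinReciprocityCharacterFiniteProofs
import HarnessLib

/-!
# The layers of a `ℤ_p`-extension with Fukuda index `n₀`: above `n₀` some prime of `K_m` is TOTALLY RAMIFIED over `K_n`
# (Washington §13.3, Lemma 13.3 + the standing assumption of Lemma 13.15; Fukuda 1994)

Topic `NumberTheory/IwasawaTheory` (namespace = path). THEOREM-ONLY file (no definition, no named fact, no `sorry`), written by
the prover seat `bsd-potss-k8t-c4` g19 (cell `bsd-potss`; Fukuda road of stmt-BirchSwinnertonDyer-19982; closes nothing).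
Companion of brick (R) `ZpExtensionLayerRamificationDichotomy` of the finite-level proof of
`fukuda1994_thm1_classNumberPExp_const_of_succ_eq`: brick (R) says every prime of `K_m` is unramified over `K` or totally
ramified over `K_n` (`n₀ ≤ n ≤ m`); this file supplies the EXISTENCE half the group-theoretic step needs — for `n₀ < m`
there IS a maximal ideal `Q` of `𝓞 K_m` whose inertia group in `Gal(K_m/K)` contains `Gal(K_m/K_n)`.
PROOF: by Washington's Lemma 13.3 for all `p` (`exists_inertia_not_le_kerSubgroup'`) some prime `𝔓` of `\bar ℤ_K` above `p`
has `I_𝔓 ⊄ ker κ`; put `Q = 𝔓 ∩ 𝓞 K_m`. If `I(Q) ≤ Gal(K_m/K)` were trivial, then `I_𝔓 ≤ Gal(K̄/K_m)` (restriction,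
`ringOfIntegersToIntegralClosure_absRestrictNormalHom_smul`, `absRestrictNormalHom_layer_eq_one_iff`), and Fukuda's hypothesis
(`I_𝔓 ≤ ker κ`, excluded, or `Gal(K̄/K_{n₀}) ≤ I_𝔓 · ker κ ≤ Gal(K̄/K_m)`) would give `p^m ∣ p^{n₀}` (`index_layerSubgroup`),
contradicting `n₀ < m`; so by brick (R) `I(Q) ⊇ Gal(K_m/K_n)`.

References: [Washington1997] §13.1 Lemma 13.3, §13.3 Lemma 13.15; [Fukuda1994] p. 264 (the index `n₀`).
-/

noncomputable section

open scoped NumberField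
open NumberField IsDedekindDomain Field IntermediateField

namespace Literature.NumberTheory.EllipticCurves.ZpExtension

open Literature.NumberTheory.GaloisRepresentations Literature.NumberTheory.IwasawaTheory

variable {K : Type} [Field K] [NumberField K] {p : ℕ} [Fact p.Prime] (κ : ZpExtension K p)

/-- **A totally ramified prime in the layers above the Fukuda index.** If every prime ramified in `K_∞/K` is totally
ramified in `K_∞/K_{n₀}` (`TotallyRamifiedFrom κ n₀`) and `n₀ ≤ n ≤ m` with `n₀ < m`, then some maximal ideal `Q` of `𝓞 K_m`
has inertia group `I(Q) ≤ Gal(K_m/K)` containing every automorphism fixing `K_n` pointwise (`Q` is totally ramified over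
`K_n`; in particular `I(Q) ≠ 1`). [cite: Washington1997, §13.1 Lemma 13.3 and §13.3 Lemma 13.15 (standing assumption)]
[cite: Fukuda1994, p. 264 (the index `n₀`)] -/
theorem exists_isMaximal_forall_mem_inertia {n₀ n m : ℕ} (hκ : TotallyRamifiedFrom κ n₀) (hn : n₀ ≤ n) (hnm : n ≤ m)
    (hm : n₀ < m) [FiniteDimensional K (κ.layer m)] [IsGalois K (κ.layer m)] :
    ∃ Q : Ideal (𝓞 (κ.layer m)), Q.IsMaximal ∧
      ∀ g : (κ.layer m) ≃ₐ[K] (κ.layer m),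
        (∀ x : κ.layer m, (x : AlgebraicClosure K) ∈ κ.layer n → g x = x) →
          g ∈ Q.inertia ((κ.layer m) ≃ₐ[K] (κ.layer m)) := by
  classical
  haveI : NumberField (κ.layer m) := NumberField.of_module_finite K (κ.layer m)
  have hp : p.Prime := Fact.out
  obtain ⟨v, 𝔓, hpv, h𝔓v, hnot⟩ := exists_inertia_not_le_kerSubgroup' κ
  haveI : 𝔓.IsPrime := h𝔓v.1
  set ι := EllipticCurves.ringOfIntegersToIntegralClosure (k := K) (Ω := AlgebraicClosure K) (κ.layer m) with hιdef
  set Q : Ideal (𝓞 (κ.layer m)) := 𝔓.comap ι with hQ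
  have hQv := comap_ringOfIntegersToIntegralClosure_mem_primesOver_of_mem_primesAbove (κ.layer m) h𝔓v
  haveI hQprime : Q.IsPrime := hQv.1
  haveI : Q.LiesOver v.asIdeal := hQv.2
  have hpQ : ((p : ℕ) : 𝓞 (κ.layer m)) ∈ Q := by
    rw [Ideal.LiesOver.over (P := Q) (p := v.asIdeal), Ideal.under, Ideal.mem_comap, map_natCast] at hpv
    exact hpv
  have hQ0 : Q ≠ ⊥ := by
    intro h0
    rw [h0, Ideal.mem_bot] at hpQ
    exact (Nat.cast_ne_zero.mpr hp.ne_zero) hpQ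
  have hQmax : Q.IsMaximal := hQprime.isMaximal hQ0
  haveI := hQmax
  refine ⟨Q, hQmax, ?_⟩
  rcases κ.inertia_layer_eq_bot_or_forall_mem hκ hn hnm Q with h1 | h2
  · -- `I(Q) = 1` is impossible above the Fukuda index
    exfalso
    have hIle : 𝔓.inertia (absoluteGaloisGroup K) ≤ κ.layerSubgroup m := by
      intro σ hσ
      rw [← κ.absRestrictNormalHom_layer_eq_one_iff m σ]
      have hmem : absRestrictNormalHom (κ.layer m) σ ∈ Q.inertia ((κ.layer m) ≃ₐ[K] (κ.layer m)) := by
        intro y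
        have h4 : ι (absRestrictNormalHom (κ.layer m) σ • y - y) ∈ 𝔓 := by
          rw [map_sub ι, hιdef, ringOfIntegersToIntegralClosure_absRestrictNormalHom_smul]
          exact hσ _
        exact Ideal.mem_comap.mpr h4
      rw [h1] at hmem
      exact hmem
    rcases hκ v 𝔓 h𝔓v with h3 | h4
    · exact hnot h3
    · have hle : κ.layerSubgroup n₀ ≤ κ.layerSubgroup m :=
        h4.trans (sup_le hIle (κ.kerSubgroup_le_layerSubgroup m))
      have hdvd := Subgroup.index_dvd_of_le hle
      rw [κ.index_layerSubgroup, κ.index_layerSubgroup, Nat.pow_dvd_pow_iff_le_right hp.one_lt] at hdvd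
      omega
  · exact h2

end Literature.NumberTheory.EllipticCurves.ZpExtension

end
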